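import Summits.AtomisticToContinuum.HydrodynamicLimit.Theorems.AntiMazurCoboundariesKineticWindowGronwallCollarLocality
import Summits.AtomisticToContinuum.HydrodynamicLimit.Theorems.AntiMazurCoboundariesKineticWindowGronwallCollarLocalityAE
import Literature.MathematicalPhysics.KineticTheory.GoodConfigurations
import Literature.Analysis.FluidPDE.HardSphereRegularGeometry
import HarnessLib

/-!
# Collar locality: the span of an influence chain under a speed cap

Companion of `AntiMazurCoboundariesKineticWindowGronwallCollarLocality` (crux `KineticWindowGronwall`,
stmt-AtomisticToContinuum-9282, line `dlr-block-transfer`, registered stub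
`stub_collarLocality : CollarInfluenceLocality`). The METRIC consequence of the influence-chain lemma on a flat
torus: every link of an influence chain is a contact (minimal-image distance `ε`) at some time of the window
`[0, T]`, in the true or in the isolated dynamics, so if every particle met moves at speed `≤ V` on the window,
consecutive members of the chain start within `ε + 2VT` of each other (`dist_zero_le_of_link`, `dist_zero_le_of_speed_le`;
triangle inequality `KineticTheory.torus_euclidDist_triangle`), and a chain of `n` links followed by
an outside contact spans at most `(n + 1)(ε + 2VT)` at time `0` (`dist_zero_le_of_isChain`). Hence
(registered helper stub `stub_collarChainSpan : CollarChainSpan`): a forecast corrupted at collar `r` within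
`[0, T]`, along data on which all speeds are `≤ V` in both dynamics, carries a chain of cluster particles
`i = p₀, …, pₙ` and an outsider `j` with `r < (n + 1)(hsDiameter σ N + 2VT)` — at least
`r / (σ(N+1)^{-1/3} + 2VT) - 1` links: with the kinetic window `T = τ(N+1)^{-1/3}` and `V = o((N+1)^{1/3})`
this is `≳ (N+1)^{1/3}` links, the combinatorial input of every large-deviation bound for `stub_collarLocality`.
Also registered here: `stub_forecastChainsAE : ForecastChainsAE` — ALMOST SURELY (under any local Gibbs law,
`stub_forecastDataGood` of the companion file `…CollarLocalityAE`) every corrupted forecast is causally connected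
to the collar's exterior within the window (`stub_influenceChain`): the form a large-deviation proof starts from.
-/

noncomputable section

namespace Summit.AtomisticToContinuum.HydrodynamicLimit.Theorems.KineticWindowGronwallCollarLocality

open MeasureTheory Set Filter Topology
open scoped ENNReal BigOperators
open Literature.MathematicalPhysics.KineticTheory (T3 V3 hsDiameter localGibbsLaw)
open Literature.Analysis Literature.Analysis.FluidPDE
open Literature.MathematicalPhysics.KineticTheory (torus_euclidDist_triangle)

section Torus

variable {d : Type*} [Fintype d] {ε : ℝ} {N k : ℕ}
  {γ : ℝ → Config N d (UnitAddTorus d)} {γ' : ℝ → Config k d (UnitAddTorus d)}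

/-- A particle of a hard-sphere trajectory on `T^d` whose speed is `≤ V` on `[0, T)` is, at every time of
`[0, T]`, within `VT` of its initial position (continuous induction over the locally finitely many collisions:
positions are continuous, and to the right of any time the particle flies freely for a while, moving by at most
`(s - x)‖v_j(x)‖`; triangle inequality `KineticTheory.torus_euclidDist_triangle`). -/
theorem dist_zero_le_of_speed_le (h : IsHardSphereTrajectory (Torus.geometry d) ε N γ) (j : Fin N)
    {T V : ℝ} (hV0 : 0 ≤ V) (hV : ∀ t ∈ Ico 0 T, ‖(γ t j).2‖ ≤ V) {t : ℝ} (ht : t ∈ Icc 0 T) :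
    Torus.euclidDist (γ t j).1 (γ 0 j).1 ≤ V * T := by
  -- a translate `x + proj a` is within `‖a‖` of `x`
  have htr : ∀ (x : UnitAddTorus d) (a : EuclideanSpace ℝ d),
      Torus.euclidDist (x + FunctionSpaces.Torus.proj a) x ≤ ‖a‖ := by
    intro x a
    have h1 := Torus.euclidDist_proj_le_norm_sub_holds (d := d) (Torus.reprSym x + a) (Torus.reprSym x)
    rwa [FunctionSpaces.Torus.proj_add, Torus.proj_reprSym, add_sub_cancel_left] at h1
  have hPc : Continuous fun s => (γ s j).1 := h.pos_continuous j
  have hgc : Continuous fun s => Torus.euclidDist (γ s j).1 (γ 0 j).1 := by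
    simpa only [Function.comp_def] using Torus.continuous_euclidDist.comp (hPc.prodMk continuous_const)
  set S : Set ℝ := {s | Torus.euclidDist (γ s j).1 (γ 0 j).1 ≤ V * s} with hS
  have hSc : IsClosed S := isClosed_le hgc (by fun_prop)
  have hmem : (0 : ℝ) ∈ S := by simp [hS]
  have key : Icc 0 T ⊆ S := by
    refine (hSc.inter isClosed_Icc).Icc_subset_of_forall_mem_nhdsWithin hmem ?_
    rintro x ⟨hxS, hx⟩
    obtain ⟨u, hxu, hfree⟩ := h.exists_Ioo_right_free x
    have hVx : ‖(γ x j).2‖ ≤ V := hV x hx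
    refine mem_of_superset (Ioo_mem_nhdsGT hxu) fun s hs => ?_
    have hsx : 0 ≤ s - x := sub_nonneg.2 hs.1.le
    have hff : γ s = freeFlight (Torus.geometry d) (s - x) (γ x) :=
      h.eq_freeFlight_of_Ioo_free hfree ⟨hs.1.le, hs.2⟩
    have hstep : Torus.euclidDist (γ s j).1 (γ x j).1 ≤ (s - x) * V := by
      rw [hff, freeFlight_apply, Torus.geometry_translate]
      calc _ ≤ ‖(s - x) • (γ x j).2‖ := htr _ _
        _ = (s - x) * ‖(γ x j).2‖ := by rw [norm_smul, Real.norm_of_nonneg hsx]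
        _ ≤ (s - x) * V := mul_le_mul_of_nonneg_left hVx hsx
    have hxS' : Torus.euclidDist (γ x j).1 (γ 0 j).1 ≤ V * x := hxS
    show Torus.euclidDist (γ s j).1 (γ 0 j).1 ≤ V * s
    calc Torus.euclidDist (γ s j).1 (γ 0 j).1
        ≤ Torus.euclidDist (γ s j).1 (γ x j).1 + Torus.euclidDist (γ x j).1 (γ 0 j).1 :=
          torus_euclidDist_triangle _ _ _
      _ ≤ (s - x) * V + V * x := add_le_add hstep hxS'
      _ = V * s := by ring
  have h1 : Torus.euclidDist (γ t j).1 (γ 0 j).1 ≤ V * t := key ht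
  exact h1.trans (mul_le_mul_of_nonneg_left ht.2 hV0)

/-- Two particles in contact (in either order) are at minimal-image distance `ε`. -/
theorem euclidDist_eq_of_mem_touching {z : Config N d (UnitAddTorus d)} {p q : Fin N}
    (h : z ∈ touching (Torus.geometry d) ε p q) : Torus.euclidDist (z p).1 (z q).1 = ε := by
  rcases h with h | h
  · exact (Torus.norm_geometry_sepVec _ _).symm.trans h.2
  · rw [Torus.euclidDist_comm]; exact (Torus.norm_geometry_sepVec _ _).symm.trans h.2

/-- **One link.** If the embedded trajectories `γ`, `γ'` agree at time `0` along `e`, all their particles move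
at speed `≤ V` on `[0, T)`, and the labels `a`, `b` are linked on the window (a contact at some time of
`[0, T]` between `e a`, `e b` in `γ`, or between `a`, `b` in `γ'`), then `e a` and `e b` start within
`ε + 2VT` of each other. -/
theorem dist_zero_le_of_link (hγ : IsHardSphereTrajectory (Torus.geometry d) ε N γ)
    (hγ' : IsHardSphereTrajectory (Torus.geometry d) ε k γ') {e : Fin k → Fin N}
    (h0 : ∀ a, γ 0 (e a) = γ' 0 a) {T V : ℝ} (hV0 : 0 ≤ V)
    (hV : ∀ t ∈ Ico 0 T, ∀ j, ‖(γ t j).2‖ ≤ V) (hV' : ∀ t ∈ Ico 0 T, ∀ a, ‖(γ' t a).2‖ ≤ V)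
    {a b : Fin k} (hab : ∃ t ∈ Icc 0 T, γ t ∈ touching (Torus.geometry d) ε (e a) (e b) ∨
      γ' t ∈ touching (Torus.geometry d) ε a b) :
    Torus.euclidDist (γ 0 (e a)).1 (γ 0 (e b)).1 ≤ ε + 2 * (V * T) := by
  obtain ⟨t, ht, h | h⟩ := hab
  · have h1 := dist_zero_le_of_speed_le hγ (e a) hV0 (fun s hs => hV s hs (e a)) ht
    have h2 := dist_zero_le_of_speed_le hγ (e b) hV0 (fun s hs => hV s hs (e b)) ht
    have h3 := euclidDist_eq_of_mem_touching h
    rw [Torus.euclidDist_comm] at h1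
    linarith [torus_euclidDist_triangle (γ 0 (e a)).1 (γ t (e a)).1 (γ 0 (e b)).1,
      torus_euclidDist_triangle (γ t (e a)).1 (γ t (e b)).1 (γ 0 (e b)).1]
  · have h1 := dist_zero_le_of_speed_le hγ' a hV0 (fun s hs => hV' s hs a) ht
    have h2 := dist_zero_le_of_speed_le hγ' b hV0 (fun s hs => hV' s hs b) ht
    have h3 := euclidDist_eq_of_mem_touching h
    rw [Torus.euclidDist_comm] at h1
    rw [h0 a, h0 b]
    linarith [torus_euclidDist_triangle (γ' 0 a).1 (γ' t a).1 (γ' 0 b).1,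
      torus_euclidDist_triangle (γ' t a).1 (γ' t b).1 (γ' 0 b).1]

/-- **Span of a chain.** Under the hypotheses of `dist_zero_le_of_link`, a chain `a :: l` of linked labels
starts and ends within `|l| (ε + 2VT)` (at time `0`). -/
theorem dist_zero_le_of_isChain (hγ : IsHardSphereTrajectory (Torus.geometry d) ε N γ)
    (hγ' : IsHardSphereTrajectory (Torus.geometry d) ε k γ') {e : Fin k → Fin N}
    (h0 : ∀ a, γ 0 (e a) = γ' 0 a) {T V : ℝ} (hV0 : 0 ≤ V)
    (hV : ∀ t ∈ Ico 0 T, ∀ j, ‖(γ t j).2‖ ≤ V) (hV' : ∀ t ∈ Ico 0 T, ∀ a, ‖(γ' t a).2‖ ≤ V) :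
    ∀ (l : List (Fin k)) (a : Fin k), List.IsChain (fun a b : Fin k => ∃ t ∈ Icc 0 T,
        γ t ∈ touching (Torus.geometry d) ε (e a) (e b) ∨ γ' t ∈ touching (Torus.geometry d) ε a b)
        (a :: l) →
      Torus.euclidDist (γ 0 (e a)).1 (γ 0 (e ((a :: l).getLast (List.cons_ne_nil _ _)))).1 ≤
        l.length * (ε + 2 * (V * T)) := by
  intro l
  induction l with
  | nil => intro a _; simp
  | cons c l ih =>
    intro a hch
    rw [List.isChain_cons_cons] at hch
    have h1 := dist_zero_le_of_link hγ hγ' h0 hV0 hV hV' hch.1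
    have h2 := ih c hch.2
    rw [List.getLast_cons_cons, List.length_cons, Nat.cast_succ, add_mul, one_mul]
    linarith [torus_euclidDist_triangle (γ 0 (e a)).1 (γ 0 (e c)).1
      (γ 0 (e ((c :: l).getLast (List.cons_ne_nil _ _)))).1]

/-- **Span of an influence chain under a speed cap** (abstract form, two trajectories on `T^d`). If `γ'`
starts from the restriction of `γ 0` along the injection `e`, disagrees with `γ` on the label `a` at some time
of `[0, T]`, and all particles of both move at speed `≤ V` on `[0, T)`, then there are a chain `a :: l` of
linked labels and a particle `j` outside the range of `e`, in contact in `γ` within the window with the last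
label of the chain, such that `dist(x_{e a}(0), x_j(0)) ≤ (|l| + 1)(ε + 2VT)`. -/
theorem exists_isChain_span_of_ne (hγ : IsHardSphereTrajectory (Torus.geometry d) ε N γ)
    (hγ' : IsHardSphereTrajectory (Torus.geometry d) ε k γ') {e : Fin k → Fin N}
    (he : Function.Injective e) (h0 : ∀ a, γ 0 (e a) = γ' 0 a) {T V : ℝ} (hV0 : 0 ≤ V)
    (hV : ∀ t ∈ Ico 0 T, ∀ j, ‖(γ t j).2‖ ≤ V) (hV' : ∀ t ∈ Ico 0 T, ∀ a, ‖(γ' t a).2‖ ≤ V)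
    {a : Fin k} (hne : ∃ t ∈ Icc 0 T, γ t (e a) ≠ γ' t a) :
    ∃ (l : List (Fin k)) (j : Fin N), j ∉ Set.range e ∧
      List.IsChain (fun a b : Fin k => ∃ t ∈ Icc 0 T,
        γ t ∈ touching (Torus.geometry d) ε (e a) (e b) ∨ γ' t ∈ touching (Torus.geometry d) ε a b)
        (a :: l) ∧
      (∃ t ∈ Icc 0 T, γ t ∈ touching (Torus.geometry d) ε
        (e ((a :: l).getLast (List.cons_ne_nil _ _))) j) ∧
      Torus.euclidDist (γ 0 (e a)).1 (γ 0 j).1 ≤ (l.length + 1) * (ε + 2 * (V * T)) := by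
  obtain ⟨b, hab, t, ht, j, hj, hbj⟩ :=
    exists_chain_of_ne Torus.continuous_geometry_translate hγ hγ' he h0 hne
  obtain ⟨l, hl, hlast⟩ := List.exists_isChain_cons_of_relationReflTransGen hab
  refine ⟨l, j, hj, hl, ⟨t, ht, hlast ▸ hbj⟩, ?_⟩
  have h1 := dist_zero_le_of_isChain hγ hγ' h0 hV0 hV hV' l a hl
  rw [hlast] at h1
  -- the last (exposure) link
  have h2 : Torus.euclidDist (γ 0 (e b)).1 (γ 0 j).1 ≤ ε + 2 * (V * T) := by
    have h3 := dist_zero_le_of_speed_le hγ (e b) hV0 (fun s hs => hV s hs (e b)) ht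
    have h4 := dist_zero_le_of_speed_le hγ j hV0 (fun s hs => hV s hs j) ht
    have h5 := euclidDist_eq_of_mem_touching hbj
    rw [Torus.euclidDist_comm] at h3
    linarith [torus_euclidDist_triangle (γ 0 (e b)).1 (γ t (e b)).1 (γ 0 j).1,
      torus_euclidDist_triangle (γ t (e b)).1 (γ t j).1 (γ 0 j).1]
  rw [add_mul, one_mul]
  linarith [torus_euclidDist_triangle (γ 0 (e a)).1 (γ 0 (e b)).1 (γ 0 j).1]

end Torus

/-! ## The registered statement -/

/-- **COLLAR CHAIN SPAN** (registered helper stub `stub_collarChainSpan` of line `dlr-block-transfer`, crux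
`KineticWindowGronwall`, stmt-AtomisticToContinuum-9282): on `𝕋³`, for the true flow `Φ` of `N + 1` spheres
of diameter `hsDiameter σ N`, a family `Ψ` of cluster flows, a datum `z` good for `Φ` whose range-`r` cluster
`S` around `i` restricts to a good datum of `Ψ S.card`, a horizon `T` and a speed cap `V ≥ 0` obeyed on
`[0, T)` by every true particle and by every particle of the isolated evolution of `S`: if the forecast of `i`
fails within `[0, T]`, there are a chain `clusterIndex i :: l` of cluster labels, consecutive ones in contact at
some time of `[0, T]` (true or isolated dynamics), and a particle `j` at initial distance `> r` from `x_i(0)`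
in contact with the last one in the true flow within `[0, T]`, and NECESSARILY
`r < (|l| + 1)(hsDiameter σ N + 2VT)`: the chain has more than `r/(σ(N+1)^{-1/3} + 2VT) - 1` links. -/
def CollarChainSpan : Prop :=
  ∀ (σ r T V : ℝ) (N : ℕ) (Φ : HardSphereFlow (Torus.geometry (Fin 3)) (hsDiameter σ N) (N + 1))
    (Ψ : (k : ℕ) → HardSphereFlow (Torus.geometry (Fin 3)) (hsDiameter σ N) k)
    (z : Config (N + 1) (Fin 3) T3) (i : Fin (N + 1)),
    z ∈ Φ.good →
    Config.restrictTo (rangeCluster (Torus.geometry (Fin 3)) r z i) z ∈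
      (Ψ (rangeCluster (Torus.geometry (Fin 3)) r z i).card).good →
    0 ≤ V → (∀ t ∈ Set.Ico 0 T, ∀ j, ‖(Φ.flow t z j).2‖ ≤ V) →
    (∀ t ∈ Set.Ico 0 T, ∀ a, ‖((Ψ (rangeCluster (Torus.geometry (Fin 3)) r z i).card).flow t
      (Config.restrictTo (rangeCluster (Torus.geometry (Fin 3)) r z i) z) a).2‖ ≤ V) →
    (∃ t ∈ Set.Icc 0 T, Φ.flow t z i ≠ localClusterState Ψ r t z i) →
    ∃ (l : List (Fin (rangeCluster (Torus.geometry (Fin 3)) r z i).card)) (j : Fin (N + 1)),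
      r < Torus.euclidDist (z i).1 (z j).1 ∧
      List.IsChain (fun a b : Fin (rangeCluster (Torus.geometry (Fin 3)) r z i).card =>
          ∃ t ∈ Set.Icc 0 T,
            Φ.flow t z ∈ touching (Torus.geometry (Fin 3)) (hsDiameter σ N)
                ((rangeCluster (Torus.geometry (Fin 3)) r z i).orderEmbOfFin rfl a)
                ((rangeCluster (Torus.geometry (Fin 3)) r z i).orderEmbOfFin rfl b) ∨
              (Ψ (rangeCluster (Torus.geometry (Fin 3)) r z i).card).flow t
                  (Config.restrictTo (rangeCluster (Torus.geometry (Fin 3)) r z i) z) ∈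
                touching (Torus.geometry (Fin 3)) (hsDiameter σ N) a b)
        (clusterIndex (rangeCluster (Torus.geometry (Fin 3)) r z i) i
          (self_mem_rangeCluster (Torus.geometry (Fin 3)) r z i) :: l) ∧
      (∃ t ∈ Set.Icc 0 T, Φ.flow t z ∈ touching (Torus.geometry (Fin 3)) (hsDiameter σ N)
        ((rangeCluster (Torus.geometry (Fin 3)) r z i).orderEmbOfFin rfl
          ((clusterIndex (rangeCluster (Torus.geometry (Fin 3)) r z i) i
            (self_mem_rangeCluster (Torus.geometry (Fin 3)) r z i) :: l).getLast (List.cons_ne_nil _ _))) j) ∧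
      r < (l.length + 1) * (hsDiameter σ N + 2 * (V * T))

/-- **STUB `stub_collarChainSpan`** (helper stub of line `dlr-block-transfer`, crux `KineticWindowGronwall`,
stmt-AtomisticToContinuum-9282): the span bound of influence chains at collar `r` under a speed cap
(`exists_isChain_span_of_ne` along the flows; `j ∉ S` reads `r < dist(x_i(0), x_j(0))`). -/
theorem stub_collarChainSpan : CollarChainSpan := by
  intro σ r T V N Φ Ψ z i hz hz' hV0 hV hV' hne
  set S := rangeCluster (Torus.geometry (Fin 3)) r z i with hS
  have hi : i ∈ S := self_mem_rangeCluster (Torus.geometry (Fin 3)) r z i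
  have hne' : ∃ t ∈ Icc 0 T, Φ.flow t z (S.orderEmbOfFin rfl (clusterIndex S i hi)) ≠
      (Ψ S.card).flow t (Config.restrictTo S z) (clusterIndex S i hi) := by
    obtain ⟨t, ht, hne⟩ := hne
    refine ⟨t, ht, ?_⟩
    rwa [orderEmbOfFin_clusterIndex, ← clusterStateIn_of_mem_good Ψ _ t hz']
  have h0 : ∀ a, Φ.flow 0 z (S.orderEmbOfFin rfl a) = (Ψ S.card).flow 0 (Config.restrictTo S z) a := by
    intro a
    rw [Φ.flow_zero z hz, (Ψ S.card).flow_zero _ hz', Config.restrictTo_apply]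
  obtain ⟨l, j, hj, hl, hlast, hdist⟩ := exists_isChain_span_of_ne (Φ.isTrajectory z hz)
    ((Ψ S.card).isTrajectory _ hz') (S.orderEmbOfFin rfl).injective h0 hV0 hV hV' hne'
  have hjS : j ∉ S := by rwa [Finset.range_orderEmbOfFin, Finset.mem_coe] at hj
  have hr : r < Torus.euclidDist (z i).1 (z j).1 := by
    rw [← Torus.norm_geometry_sepVec]
    exact lt_of_not_ge fun h => hjS (mem_rangeCluster.2 (Or.inr h))
  refine ⟨l, j, hr, hl, hlast, ?_⟩
  rw [orderEmbOfFin_clusterIndex, Φ.flow_zero z hz] at hdist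
  exact hr.trans_le hdist

/-- **ALMOST SURELY, EVERY CORRUPTED FORECAST IS CAUSALLY CONNECTED TO THE COLLAR'S EXTERIOR** (registered
helper stub `stub_forecastChainsAE` of line `dlr-block-transfer`, crux `KineticWindowGronwall`,
stmt-AtomisticToContinuum-9282). Under any local Gibbs law on `𝕋³` (any profiles, any `σ`), for almost every
datum `z` and EVERY particle `i`: if the range-`r` forecast of `i` fails at some time of `[0, T]`, then the
cluster label of `i` is chained by window contacts (true or isolated cluster dynamics) to a cluster particle
touching, in the true flow within `[0, T]`, a particle `j` with `Torus.euclidDist (x_i(0)) (x_j(0)) > r`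
(`stub_forecastDataGood` and `stub_influenceChain`). This is the form a large-deviation proof of
`CollarInfluenceLocality` starts from: the bad set of the stub is contained, up to a null set, in the set of
particles causally connected across the collar within the window. -/
def ForecastChainsAE : Prop :=
  ∀ (σ : ℝ) (a₀ θ₀ : T3 → ℝ) (u₀ : T3 → V3) (N : ℕ)
    (Φ : HardSphereFlow (Torus.geometry (Fin 3)) (hsDiameter σ N) (N + 1))
    (Ψ : (k : ℕ) → HardSphereFlow (Torus.geometry (Fin 3)) (hsDiameter σ N) k) (r T : ℝ),
    ∀ᵐ z ∂(localGibbsLaw σ a₀ u₀ θ₀ N Φ), ∀ i : Fin (N + 1),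
      (∃ t ∈ Set.Icc 0 T, Φ.flow t z i ≠ localClusterState Ψ r t z i) →
      ∃ b : Fin (rangeCluster (Torus.geometry (Fin 3)) r z i).card,
        Relation.ReflTransGen (fun a b : Fin (rangeCluster (Torus.geometry (Fin 3)) r z i).card =>
            ∃ t ∈ Set.Icc 0 T,
              Φ.flow t z ∈ touching (Torus.geometry (Fin 3)) (hsDiameter σ N)
                  ((rangeCluster (Torus.geometry (Fin 3)) r z i).orderEmbOfFin rfl a)
                  ((rangeCluster (Torus.geometry (Fin 3)) r z i).orderEmbOfFin rfl b) ∨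
                (Ψ (rangeCluster (Torus.geometry (Fin 3)) r z i).card).flow t
                    (Config.restrictTo (rangeCluster (Torus.geometry (Fin 3)) r z i) z) ∈
                  touching (Torus.geometry (Fin 3)) (hsDiameter σ N) a b)
          (clusterIndex (rangeCluster (Torus.geometry (Fin 3)) r z i) i
            (self_mem_rangeCluster (Torus.geometry (Fin 3)) r z i)) b ∧
        ∃ t ∈ Set.Icc 0 T, ∃ j : Fin (N + 1), j ≠ i ∧ r < Torus.euclidDist (z i).1 (z j).1 ∧
          Φ.flow t z ∈ touching (Torus.geometry (Fin 3)) (hsDiameter σ N)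
            ((rangeCluster (Torus.geometry (Fin 3)) r z i).orderEmbOfFin rfl b) j

/-- **STUB `stub_forecastChainsAE`** (helper stub of line `dlr-block-transfer`, crux `KineticWindowGronwall`,
stmt-AtomisticToContinuum-9282): almost surely every corrupted forecast is causally connected to the collar's
exterior within the window (`stub_forecastDataGood` + `stub_influenceChain`). -/
theorem stub_forecastChainsAE : ForecastChainsAE := by
  intro σ a₀ θ₀ u₀ N Φ Ψ r T
  filter_upwards [stub_forecastDataGood σ a₀ θ₀ u₀ N Φ Ψ r] with z hz
  exact fun i hne => stub_influenceChain σ r T N Φ Ψ z i hz.1 (hz.2 i) hne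

end Summit.AtomisticToContinuum.HydrodynamicLimit.Theorems.KineticWindowGronwallCollarLocality

end
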